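import Summits.Ventures.GridStability.Models.InverterVSM
import Summits.Ventures.GridStability.Models.InverterDroop
import Literature.Analysis.ODE.RouthHurwitzLowOrder

/-!
# GridStability/Models/InverterVSMQDroopLinearisation — the THREE-state grid-forming model WITH the reactive-power/voltage droop loop (VSM ≡ droop-with-filter + Q–V droop vs an infinite bus): Jacobian, characteristic cubic, and the small-signal condition IN CLOSED FORM

Cell `gridfusion` (LADDER-GRIDFUSION, APEX LINE; wave-1 candidate row «G3-ss» — certnum RQ-013 names «VSM +
reactive loop / droop with Q–V droop / SRF-PLL with filter» as the 3-state families needing a box tool;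
seat gridfusion-model-3 (g5)). MODEL-SIDE input, the 3-state sibling of `Models/InverterLinearisation.lean`
(p490298, 2 states). RESULT: for this family NO TOOL IS NEEDED EITHER — Routh–Hurwitz for the cubic
collapses to ONE inequality (`hurwitz_iff_of_signs`).

THE MODEL (COMPOSED — flagged, like `InverterPLL.vgqComposed`): the VSM outer control AS PRINTED
[cite: HenriquezAuba2022, eqs. (2.59a)–(2.59d) = (2.6)–(2.9)] (`InverterVSM.VsmOuterLoop.{dθ, dω, dqf, voc}`:
`θ̇ = Ω_b(ω − ω_s)`, `ω̇ = (1/M)[(p* − p_e) + (1/k_p)(ω* − ω)]`, `q̇_f = ω_z(q_e − q_f)`,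
`v = v* + k_q(q* − q_f)`) CLOSED against an infinite bus `V_g∠0` through a reactance `X` by the printed
quasi-static converter-terminal power maps [cite: Qoria2020, eqs. (II-32)–(II-33)]
(`InverterDroop.pInductive/qInductive`: `p_e = v V_g sin θ / X`, `q_e = v(v − V_g cos θ)/X`) evaluated at
the commanded voltage magnitude `v = v_oc^{d,⋆}(q_f)` (ideal inner loops). States `(θ, ω, q_f)`; by the
droop ≡ VSM identity (`InverterDroop.DroopOuterLoop.hasDerivAt_omegaOc`, `M = 1/(ω_z k_p)`) the same
3-state model covers the droop outer loop (2.58a)–(2.58e). MODELLED: MV-6D + «Q–V droop loop, quasi-static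
network, ideal voltage tracking»; COMPOSED (the closure is ours; the thesis closes (2.59) through full-order
inner loops and an algebraic or dynamic network, §2.4).

WHAT IS PROVED ([folklore] calculus/algebra on the typed model; the only cited theorem is Routh–Hurwitz):
* `field3`, `jac3 θ q_f` (`= [[0, Ω_b, 0], [−vV_g cos θ/(MX), −1/(Mk_p), k_qV_g sin θ/(MX)],
  [ω_z vV_g sin θ/X, 0, −ω_z(1 + k_q(2v − V_g cos θ)/X)]]`, `v = v* + k_q(q* − q_f)`), `hasFDerivAt_field3`
  (the Jacobian IS the Fréchet derivative at every state; it does not depend on `ω`);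
* `jac3_affine`: `J = J₀ + k_q·J₁` with `J₀, J₁` free of `k_q` AT FIXED `v` — the affine `J(p)` shape certnum's
  `hurwitz_margin` consumes (and `−1/(Mk_p)` enters one entry linearly: a second affine parameter `1/k_p`);
* `det_charMatrix3`: `det(z·1 − J) = z³ + (d + g)z² + (dg + aΩ_b)z + Ω_b(ag − ef)` with
  `a = vV_g cos θ/(MX)`, `d = 1/(Mk_p)`, `e = k_qV_g sin θ/(MX)`, `f = ω_z vV_g sin θ/X`,
  `g = ω_z(1 + k_q(2v − V_g cos θ)/X)`;
* `hurwitz_iff` — Routh–Hurwitz for the cubic [cite: HairerNorsettWanner1993, §I.13 Theorem 13.4]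
  (`Literature.Analysis.ODE.RouthHurwitz.cubic_iff`): all roots in `Re z < 0` iff
  `0 < d + g ∧ 0 < Ω_b(ag − ef) ∧ 0 < (d + g)(dg + aΩ_b) − Ω_b(ag − ef)`;
* **`hurwitz_iff_of_signs`** — with `Ω_b, M, k_p, ω_z, X, V_g, v > 0`, `k_q ≥ 0` and a stable voltage loop
  (`0 < 1 + k_q(2v − V_g cos θ)/X`) this is EXACTLY ONE inequality:
  `cos θ + (k_q/X)(2v cos θ − V_g) > 0`; corollaries `hurwitz_of_two_v_cos_ge` («NO upper limit on `k_q`»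
  when `2v cos θ ≥ V_g` and `cos θ > 0`), `hurwitz_iff_kq_lt` (else the critical gain
  `k_q < X cos θ/(V_g − 2v cos θ)`), `hurwitz_iff_cos_pos_of_kq_zero` (`k_q = 0`: `cos θ > 0`, the 2-state row).

VALIDATED (qualitative, not used): [cite: HenriquezAuba2022, §2.4 Case 2, Fig. 2.25] reports for the ALGEBRAIC
network model «the reactive power droop `k_q` has a minor effect on the stability regions … the full algebraic
model for the AC side yields no upper limit for the stability on `k_q`» (nominal `k_p = k_q = 0.02`) — the
closed form above says the same for this reduction whenever `2v* cos θ* ≥ V_g`, and names the critical `k_q`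
otherwise; the thesis's point that DYNAMIC lines change the picture is a MODEL-VALIDITY caveat (MV-INV-1),
outside this 3-state model. THREE COLUMNS: CERTIFIED = statements about the matrix `J`; nothing about the
nonlinear flow; no parameter values (no instance of record has a Q–V droop datum); no sentence says a
converter or a grid is stable.
-/

noncomputable section

open Real Matrix

namespace Summit.Ventures.GridStability.Models

namespace InverterVSM.VsmOuterLoop

variable (V : VsmOuterLoop)

/-! ## §1 The composed 3-state model -/

/-- Active power delivered to the infinite bus `V_g∠0` through the reactance `X` at the commanded voltage
magnitude `v = v_oc^{d,⋆}(q_f)`: `p_e = v V_g sin θ / X` ([cite: Qoria2020, eq. (II-32)] at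
`v = ` [cite: HenriquezAuba2022, eq. (2.59d)]). COMPOSED. -/
def pe3 (Vg X θ qf : ℝ) : ℝ := InverterDroop.pInductive (V.voc qf) Vg X θ

/-- Reactive power at the converter terminal: `q_e = v(v − V_g cos θ)/X` ([cite: Qoria2020, eq. (II-33)]
at `v = v_oc^{d,⋆}(q_f)`). COMPOSED. -/
def qe3 (Vg X θ qf : ℝ) : ℝ := InverterDroop.qInductive (V.voc qf) Vg X θ

/-- **The 3-state grid-forming model with Q–V droop** on `Fin 3 → ℝ` (state `x = (θ, ω, q_f)`):
`(Ω_b(ω − ω_s), (1/M)[(p* − p_e) + (1/k_p)(ω* − ω)], ω_z(q_e − q_f))` — [cite: HenriquezAuba2022,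
eqs. (2.59a)–(2.59d)] closed by [cite: Qoria2020, eqs. (II-32)–(II-33)]. MODELLED: MV-6D + Q–V loop;
COMPOSED. -/
def field3 (Vg X : ℝ) (x : Fin 3 → ℝ) : Fin 3 → ℝ :=
  ![V.dθ (x 1), V.dω (V.pe3 Vg X (x 0) (x 2)) (x 1), V.dqf (V.qe3 Vg X (x 0) (x 2)) (x 2)]

/-- `field3` written out (division as multiplication by the inverse). [folklore] -/
theorem field3_eq (Vg X : ℝ) : V.field3 Vg X = fun x =>
    ![V.Ωb * (x 1 - V.ωs),
      1 / V.M * ((V.pref - V.voc (x 2) * Vg * X⁻¹ * sin (x 0)) + 1 / V.kp * (V.ωref - x 1)),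
      V.ωz * (V.voc (x 2) * (V.voc (x 2) - Vg * cos (x 0)) * X⁻¹ - x 2)] := by
  funext x
  simp [field3, dθ, dω, dqf, pe3, qe3, InverterDroop.pInductive, InverterDroop.qInductive, div_eq_mul_inv]

/-- At a rest point of the model the frequency is the grid frequency, the active power balances the droop
offset and the filter tracks the reactive power: `field3 x = 0` iff `Ω_b(x₁ − ω_s) = 0`,
`(1/M)[(p* − p_e) + (1/k_p)(ω* − x₁)] = 0`, `ω_z(q_e − x₂) = 0`. [folklore] -/
theorem field3_eq_zero_iff (Vg X : ℝ) (x : Fin 3 → ℝ) :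
    V.field3 Vg X x = 0 ↔ V.dθ (x 1) = 0 ∧ V.dω (V.pe3 Vg X (x 0) (x 2)) (x 1) = 0 ∧
      V.dqf (V.qe3 Vg X (x 0) (x 2)) (x 2) = 0 := by
  constructor
  · intro h
    exact ⟨by simpa [field3] using congr_fun h 0, by simpa [field3] using congr_fun h 1,
      by simpa [field3] using congr_fun h 2⟩
  · rintro ⟨h0, h1, h2⟩
    funext i
    fin_cases i <;> simp [field3, h0, h1, h2]

/-! ## §2 The Jacobian -/

/-- **The Jacobian of the 3-state model at a state with angle `θ` and filter state `q_f`** (independent of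
`ω`), `v = v* + k_q(q* − q_f)`:
`[[0, Ω_b, 0], [−vV_g cos θ/(MX), −1/(Mk_p), k_qV_g sin θ/(MX)], [ω_z vV_g sin θ/X, 0, −ω_z(1 + k_q(2v − V_g cos θ)/X)]]`.
[folklore] -/
def jac3 (Vg X θ qf : ℝ) : Matrix (Fin 3) (Fin 3) ℝ :=
  !![0, V.Ωb, 0;
    -(V.voc qf * Vg * cos θ / (V.M * X)), -(1 / (V.M * V.kp)), V.kq * Vg * sin θ / (V.M * X);
    V.ωz * (V.voc qf * Vg * sin θ / X), 0, -(V.ωz * (1 + V.kq * (2 * V.voc qf - Vg * cos θ) / X))]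

/-- The Jacobian as a continuous linear map on `Fin 3 → ℝ` (`u ↦ J u`). [folklore] -/
def jacCLM3 (Vg X θ qf : ℝ) : (Fin 3 → ℝ) →L[ℝ] (Fin 3 → ℝ) :=
  LinearMap.toContinuousLinearMap (V.jac3 Vg X θ qf).mulVecLin

/-- `jacCLM3` IS `jac3` acting on the state vector. [folklore] -/
@[simp] theorem jacCLM3_apply (Vg X θ qf : ℝ) (u : Fin 3 → ℝ) :
    V.jacCLM3 Vg X θ qf u = V.jac3 Vg X θ qf *ᵥ u := by
  simp [jacCLM3]

/-- **Linearisation (kernel fact): `field3` is Fréchet differentiable at every state with derivative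
`jacCLM3 (x 0) (x 2)` (= `jac3`).** MODELLED: MV-6D + Q–V loop; COMPOSED. [folklore] -/
theorem hasFDerivAt_field3 (Vg X : ℝ) (x : Fin 3 → ℝ) :
    HasFDerivAt (V.field3 Vg X) (V.jacCLM3 Vg X (x 0) (x 2)) x := by
  have h0 : HasFDerivAt (fun y : Fin 3 → ℝ => y 0) (ContinuousLinearMap.proj 0) x :=
    hasFDerivAt_apply (𝕜 := ℝ) 0 x
  have h1 : HasFDerivAt (fun y : Fin 3 → ℝ => y 1) (ContinuousLinearMap.proj 1) x :=
    hasFDerivAt_apply (𝕜 := ℝ) 1 x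
  have h2 : HasFDerivAt (fun y : Fin 3 → ℝ => y 2) (ContinuousLinearMap.proj 2) x :=
    hasFDerivAt_apply (𝕜 := ℝ) 2 x
  have hv : HasFDerivAt (fun y : Fin 3 → ℝ => V.voc (y 2))
      (V.kq • (-(ContinuousLinearMap.proj (R := ℝ) (φ := fun _ : Fin 3 => ℝ) 2))) x := by
    unfold voc
    exact ((h2.const_sub V.qref).const_mul V.kq).const_add V.vref
  have hsin := (Real.hasDerivAt_sin (x 0)).comp_hasFDerivAt x h0
  have hcos := (Real.hasDerivAt_cos (x 0)).comp_hasFDerivAt x h0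
  rw [V.field3_eq Vg X]
  refine hasFDerivAt_pi'' fun i => ?_
  fin_cases i
  · -- θ̇ = Ω_b (ω − ω_s)
    show HasFDerivAt (fun y : Fin 3 → ℝ => V.Ωb * (y 1 - V.ωs)) _ x
    refine ((h1.sub_const V.ωs).const_mul V.Ωb).congr_fderiv ?_
    ext u
    simp [jac3, dotProduct, Fin.sum_univ_three]
  · -- ω̇
    show HasFDerivAt (fun y : Fin 3 → ℝ =>
      1 / V.M * ((V.pref - V.voc (y 2) * Vg * X⁻¹ * sin (y 0)) + 1 / V.kp * (V.ωref - y 1))) _ x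
    have hpe := ((hv.mul_const Vg).mul_const X⁻¹).mul hsin
    refine (((hpe.const_sub V.pref).add ((h1.const_sub V.ωref).const_mul (1 / V.kp))).const_mul
      (1 / V.M)).congr_fderiv ?_
    ext u
    simp [jac3, dotProduct, Fin.sum_univ_three, voc]
    ring
  · -- q̇_f
    show HasFDerivAt (fun y : Fin 3 → ℝ =>
      V.ωz * (V.voc (y 2) * (V.voc (y 2) - Vg * cos (y 0)) * X⁻¹ - y 2)) _ x
    have hqe := ((hv.mul (hv.sub (hcos.const_mul Vg))).mul_const X⁻¹)
    refine (((hqe.sub h2).const_mul V.ωz)).congr_fderiv ?_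
    ext u
    simp [jac3, dotProduct, Fin.sum_univ_three, voc]
    ring

/-- **Affine parameter dependence (certnum's `J(p)` shape).** At a fixed commanded voltage `v` (write the
entries with `v` in place of `v_oc^{d,⋆}(q_f)`), the Jacobian is `J₀ + k_q·J₁` with `J₀`, `J₁` free of
`k_q`; the damping gain enters the single entry `−1/(Mk_p)` linearly in `1/k_p`. [folklore] -/
theorem jac3_affine (Vg X θ qf : ℝ) :
    V.jac3 Vg X θ qf =
      !![0, V.Ωb, 0;
        -(V.voc qf * Vg * cos θ / (V.M * X)), -(1 / (V.M * V.kp)), 0;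
        V.ωz * (V.voc qf * Vg * sin θ / X), 0, -V.ωz]
      + V.kq • !![0, 0, 0;
        0, 0, Vg * sin θ / (V.M * X);
        0, 0, -(V.ωz * (2 * V.voc qf - Vg * cos θ) / X)] := by
  ext i j
  fin_cases i <;> fin_cases j <;> simp [jac3] <;> ring

/-! ## §3 Characteristic cubic and Routh–Hurwitz in closed form -/

/-- Shorthands of the characteristic cubic: `a = vV_g cos θ/(MX)`. [folklore] -/
def cA (Vg X θ qf : ℝ) : ℝ := V.voc qf * Vg * cos θ / (V.M * X)
/-- `d = 1/(Mk_p)`. [folklore] -/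
def cD : ℝ := 1 / (V.M * V.kp)
/-- `e = k_qV_g sin θ/(MX)`. [folklore] -/
def cE (Vg X θ : ℝ) : ℝ := V.kq * Vg * sin θ / (V.M * X)
/-- `f = ω_z vV_g sin θ/X`. [folklore] -/
def cF (Vg X θ qf : ℝ) : ℝ := V.ωz * (V.voc qf * Vg * sin θ / X)
/-- `g = ω_z(1 + k_q(2v − V_g cos θ)/X)`. [folklore] -/
def cG (Vg X θ qf : ℝ) : ℝ := V.ωz * (1 + V.kq * (2 * V.voc qf - Vg * cos θ) / X)

/-- **Characteristic polynomial**: `det(z·1 − J) = z³ + (d + g)z² + (dg + aΩ_b)z + Ω_b(ag − ef)`. [folklore] -/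
theorem det_charMatrix3 (Vg X θ qf : ℝ) (z : ℂ) :
    (z • (1 : Matrix (Fin 3) (Fin 3) ℂ) - (V.jac3 Vg X θ qf).map ((↑) : ℝ → ℂ)).det
      = z ^ 3 + ((V.cD + V.cG Vg X θ qf : ℝ) : ℂ) * z ^ 2
        + ((V.cD * V.cG Vg X θ qf + V.cA Vg X θ qf * V.Ωb : ℝ) : ℂ) * z
        + ((V.Ωb * (V.cA Vg X θ qf * V.cG Vg X θ qf - V.cE Vg X θ * V.cF Vg X θ qf) : ℝ) : ℂ) := by
  simp [Matrix.det_fin_three, jac3, cA, cD, cE, cF, cG]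
  ring

/-- **Routh–Hurwitz for the 3-state model, exact**: every root of the characteristic equation has `Re z < 0`
iff `0 < d + g`, `0 < Ω_b(ag − ef)` and `0 < (d + g)(dg + aΩ_b) − Ω_b(ag − ef)`.
[cite: HairerNorsettWanner1993, §I.13 Theorem 13.4] -/
theorem hurwitz_iff (Vg X θ qf : ℝ) :
    (∀ z : ℂ, (z • (1 : Matrix (Fin 3) (Fin 3) ℂ) - (V.jac3 Vg X θ qf).map ((↑) : ℝ → ℂ)).det = 0 → z.re < 0)
      ↔ 0 < V.cD + V.cG Vg X θ qf ∧
        0 < V.Ωb * (V.cA Vg X θ qf * V.cG Vg X θ qf - V.cE Vg X θ * V.cF Vg X θ qf) ∧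
        0 < (V.cD + V.cG Vg X θ qf) * (V.cD * V.cG Vg X θ qf + V.cA Vg X θ qf * V.Ωb)
          - V.Ωb * (V.cA Vg X θ qf * V.cG Vg X θ qf - V.cE Vg X θ * V.cF Vg X θ qf) := by
  simp only [V.det_charMatrix3]
  exact Literature.Analysis.ODE.RouthHurwitz.cubic_iff _ _ _

/-- **The small-signal condition in ONE inequality.** With positive base frequency, inertia, damping gain,
filter cut-off, reactance, grid voltage and commanded voltage `v = v* + k_q(q* − q_f) > 0`, a nonnegative
Q–V droop gain and a stable voltage loop (`0 < 1 + k_q(2v − V_g cos θ)/X`), the linearisation is Hurwitz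
iff `0 < cos θ + (k_q/X)(2v cos θ − V_g)`. (The third Routh–Hurwitz condition is automatic:
`(d+g)(dg+aΩ_b) − Ω_b(ag − ef) = d²g + dg² + dΩ_b a + Ω_b ef` with `ef ≥ 0`, and the second forces
`cos θ > 0`, hence `a > 0`.) [cite: HairerNorsettWanner1993, §I.13 Theorem 13.4] -/
theorem hurwitz_iff_of_signs {Vg X θ qf : ℝ} (hb : 0 < V.Ωb) (hM : 0 < V.M) (hkp : 0 < V.kp)
    (hz : 0 < V.ωz) (hX : 0 < X) (hVg : 0 < Vg) (hv : 0 < V.voc qf) (hkq : 0 ≤ V.kq)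
    (hloop : 0 < 1 + V.kq * (2 * V.voc qf - Vg * cos θ) / X) :
    (∀ z : ℂ, (z • (1 : Matrix (Fin 3) (Fin 3) ℂ) - (V.jac3 Vg X θ qf).map ((↑) : ℝ → ℂ)).det = 0 → z.re < 0)
      ↔ 0 < cos θ + V.kq / X * (2 * V.voc qf * cos θ - Vg) := by
  rw [V.hurwitz_iff]
  set v := V.voc qf with hvdef
  have hd : 0 < V.cD := by unfold cD; positivity
  have hg : 0 < V.cG Vg X θ qf := by unfold cG; exact mul_pos hz hloop
  have hef : 0 ≤ V.cE Vg X θ * V.cF Vg X θ qf := by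
    have : V.cE Vg X θ * V.cF Vg X θ qf = V.kq * V.ωz * V.voc qf * Vg ^ 2 * (sin θ) ^ 2 / (V.M * X ^ 2) := by
      unfold cE cF; field_simp
    rw [this]; positivity
  -- the key identity: ag − ef = (ω_z v V_g/(MX)) · (cos θ + (k_q/X)(2v cos θ − V_g))
  have hkey : V.cA Vg X θ qf * V.cG Vg X θ qf - V.cE Vg X θ * V.cF Vg X θ qf
      = V.ωz * V.voc qf * Vg / (V.M * X) * (cos θ + V.kq / X * (2 * V.voc qf * cos θ - Vg)) := by
    unfold cA cG cE cF
    field_simp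
    have hs : sin θ ^ 2 = 1 - cos θ ^ 2 := by rw [← Real.sin_sq_add_cos_sq θ]; ring
    rw [hs]
    ring
  have hpref : 0 < V.ωz * V.voc qf * Vg / (V.M * X) := by positivity
  constructor
  · rintro ⟨-, h2, -⟩
    rw [hkey] at h2
    exact (mul_pos_iff_of_pos_left hpref).1 ((mul_pos_iff_of_pos_left hb).1 h2)
  · intro h
    have hcos : 0 < cos θ := by
      by_contra hc
      push Not at hc
      have h1 : 2 * V.voc qf * cos θ - Vg < 0 := by nlinarith
      have h2 : V.kq / X * (2 * V.voc qf * cos θ - Vg) ≤ 0 :=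
        mul_nonpos_of_nonneg_of_nonpos (div_nonneg hkq hX.le) h1.le
      linarith
    have ha : 0 < V.cA Vg X θ qf := by unfold cA; positivity
    refine ⟨add_pos hd hg, ?_, ?_⟩
    · rw [hkey]
      exact mul_pos hb (mul_pos hpref h)
    · have hid : (V.cD + V.cG Vg X θ qf) * (V.cD * V.cG Vg X θ qf + V.cA Vg X θ qf * V.Ωb)
          - V.Ωb * (V.cA Vg X θ qf * V.cG Vg X θ qf - V.cE Vg X θ * V.cF Vg X θ qf)
          = V.cD ^ 2 * V.cG Vg X θ qf + V.cD * V.cG Vg X θ qf ^ 2 + V.cD * V.Ωb * V.cA Vg X θ qf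
            + V.Ωb * (V.cE Vg X θ * V.cF Vg X θ qf) := by ring
      rw [hid]
      positivity

/-- **No upper limit on the Q–V droop gain** in this reduction when `2v cos θ ≥ V_g` (and `cos θ > 0`): the
linearisation is Hurwitz for EVERY `k_q ≥ 0` (hypotheses as in `hurwitz_iff_of_signs`). Cf. the VALIDATED
remark [cite: HenriquezAuba2022, §2.4 Case 2, Fig. 2.25] («the full algebraic model for the AC side yields
no upper limit for the stability on `k_q`»). CERTIFIED: a matrix statement; MODELLED: COMPOSED 3-state
model. [cite: HairerNorsettWanner1993, §I.13 Theorem 13.4] -/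
theorem hurwitz_of_two_v_cos_ge {Vg X θ qf : ℝ} (hb : 0 < V.Ωb) (hM : 0 < V.M) (hkp : 0 < V.kp)
    (hz : 0 < V.ωz) (hX : 0 < X) (hVg : 0 < Vg) (hv : 0 < V.voc qf) (hkq : 0 ≤ V.kq)
    (hcos : 0 < cos θ) (h2v : Vg ≤ 2 * V.voc qf * cos θ) :
    ∀ z : ℂ, (z • (1 : Matrix (Fin 3) (Fin 3) ℂ) - (V.jac3 Vg X θ qf).map ((↑) : ℝ → ℂ)).det = 0 →
      z.re < 0 := by
  have hloop : 0 < 1 + V.kq * (2 * V.voc qf - Vg * cos θ) / X := by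
    have hc1 : cos θ ≤ 1 := Real.cos_le_one θ
    have : 0 ≤ 2 * V.voc qf - Vg * cos θ := by nlinarith
    positivity
  refine (V.hurwitz_iff_of_signs hb hM hkp hz hX hVg hv hkq hloop).2 ?_
  have : 0 ≤ V.kq / X * (2 * V.voc qf * cos θ - Vg) := mul_nonneg (div_nonneg hkq hX.le) (by linarith)
  linarith

/-- **The critical Q–V droop gain** when `2v cos θ < V_g` (with `cos θ > 0`): Hurwitz iff
`k_q < X cos θ/(V_g − 2v cos θ)`. CERTIFIED: a matrix statement; MODELLED: COMPOSED 3-state model.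
[cite: HairerNorsettWanner1993, §I.13 Theorem 13.4] -/
theorem hurwitz_iff_kq_lt {Vg X θ qf : ℝ} (hb : 0 < V.Ωb) (hM : 0 < V.M) (hkp : 0 < V.kp)
    (hz : 0 < V.ωz) (hX : 0 < X) (hVg : 0 < Vg) (hv : 0 < V.voc qf) (hkq : 0 ≤ V.kq)
    (hloop : 0 < 1 + V.kq * (2 * V.voc qf - Vg * cos θ) / X) (h2v : 2 * V.voc qf * cos θ < Vg) :
    (∀ z : ℂ, (z • (1 : Matrix (Fin 3) (Fin 3) ℂ) - (V.jac3 Vg X θ qf).map ((↑) : ℝ → ℂ)).det = 0 → z.re < 0)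
      ↔ V.kq < X * cos θ / (Vg - 2 * V.voc qf * cos θ) := by
  rw [V.hurwitz_iff_of_signs hb hM hkp hz hX hVg hv hkq hloop]
  have hden : 0 < Vg - 2 * V.voc qf * cos θ := by linarith
  rw [lt_div_iff₀ hden]
  constructor
  · intro h
    have := mul_pos h hX
    have hx : (cos θ + V.kq / X * (2 * V.voc qf * cos θ - Vg)) * X
        = X * cos θ - V.kq * (Vg - 2 * V.voc qf * cos θ) := by field_simp; ring
    linarith [hx ▸ this]
  · intro h
    have hx : cos θ + V.kq / X * (2 * V.voc qf * cos θ - Vg)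
        = (X * cos θ - V.kq * (Vg - 2 * V.voc qf * cos θ)) / X := by field_simp; ring
    rw [hx]
    exact div_pos (by linarith) hX

/-- **Without the Q–V droop (`k_q = 0`) the condition is `cos θ > 0`** — the 2-state droop/VSM row
(`InverterDroop.ReducedParams.hurwitz_iff`, p490298) recovered inside the 3-state model (the voltage filter
adds the stable real pole `−ω_z`). [cite: HairerNorsettWanner1993, §I.13 Theorem 13.4] -/
theorem hurwitz_iff_cos_pos_of_kq_zero {Vg X θ qf : ℝ} (hb : 0 < V.Ωb) (hM : 0 < V.M) (hkp : 0 < V.kp)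
    (hz : 0 < V.ωz) (hX : 0 < X) (hVg : 0 < Vg) (hv : 0 < V.voc qf) (hkq : V.kq = 0) :
    (∀ z : ℂ, (z • (1 : Matrix (Fin 3) (Fin 3) ℂ) - (V.jac3 Vg X θ qf).map ((↑) : ℝ → ℂ)).det = 0 → z.re < 0)
      ↔ 0 < cos θ := by
  rw [V.hurwitz_iff_of_signs hb hM hkp hz hX hVg hv hkq.symm.le (by rw [hkq]; simp)]
  simp [hkq]

end InverterVSM.VsmOuterLoop

end Summit.Ventures.GridStability.Models

end
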